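import Summits.AnomalousDissipation.AnomalousDissipation.Theorems.SoloBlindEnergyFloorChebyshev

/-!
# Solo (blind) — the Chebyshev energy floor at FIXED viscosity, for a single solution

`Theorems/SoloBlindEnergyFloorChebyshev` gives `E ≥ 1/(π√3)` along vanishing-viscosity FAMILIES.
Here the same smooth two-mode multiplier `Ψ = (cos(2πx₃)/(3π) + cos(6πx₃)/(54π)) e₁` is fed to
the single-solution momentum balance `forcePairing_le_of_meanEnergy_le`
(`∫⟪f,Ψ⟫ ≤ c·E + ν‖ΔΨ‖₂ √E`, `Theorems/SoloBlindEnergyFloorLH`): with `∫⟪f,Ψ⟫ = 1/(6π)`,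
`c = √3/6` and the pointwise bound `‖ΔΨ‖ ≤ 4π/3 + 2π/3 = 2π` one gets, for EVERY global
Leray–Hopf solution of `NS_ν(cos(2πx₃)e₁)` at a fixed viscosity `ν > 0` (any datum, any momentum,
no uniqueness / regularity / energy equality) whose `limsup` Cesàro mean energy is `≤ E`,

  `1/(6π) ≤ (√3/6)·E + 2πν·√E`,   i.e.   `E + 4√3·π·ν·√E ≥ 1/(π√3)`

(`kolmogorov_meanEnergy_floor_fixedViscosity`, `kolmogorov_energyBound_ge_chebyshev_fixedViscosity`):
the inertial energy floor `1/(π√3) ≈ 0.184` is approached at rate `ν`.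
[cite: DoeringFoias2002, §3] [cite: DoeringEckhardtSchumacher2003, Lemma 2]
-/

open MeasureTheory Filter Topology Set UnitAddTorus
open scoped ENNReal NNReal InnerProductSpace

noncomputable section

namespace Summit.AnomalousDissipation.AnomalousDissipation.Theorems

open Literature.Analysis.FunctionSpaces Literature.Analysis.FunctionSpaces.Torus
open Literature.Analysis.FluidPDE

/-- The multiplier amplitudes are non-negative. [folklore] -/
theorem chebAmp_nonneg (n : ℤ) : 0 ≤ chebAmp n := by
  unfold chebAmp
  split_ifs <;> positivity

/-- `‖chebCoeff k‖ = chebAmp(k₃)/2`. [folklore] -/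
theorem norm_chebCoeff (k : Fin 3 → ℤ) : ‖chebCoeff k‖ = chebAmp (k 2) * (1 / 2) := by
  rw [chebCoeff, norm_smul, norm_kolVec, Complex.norm_real, Real.norm_eq_abs,
    abs_of_nonneg (chebAmp_nonneg _)]

/-- `|3e₃|² = 9`. [folklore] -/
theorem freqNormSq_chebFreq : freqNormSq chebFreq = 9 := by
  simp [freqNormSq, Fin.sum_univ_three, chebFreq]
  norm_num

/-- Norm of a Laplacian coefficient `‖-(4π²|k|² • chebCoeff k)‖ = 2π²|k|²·chebAmp(k₃)`. [folklore] -/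
theorem norm_laplacianCoeff_chebPsi (k : Fin 3 → ℤ) :
    ‖-((((4 * Real.pi ^ 2 * freqNormSq k : ℝ)) : ℂ) • chebCoeff k)‖ =
      4 * Real.pi ^ 2 * freqNormSq k * (chebAmp (k 2) * (1 / 2)) := by
  have hk := freqNormSq_nonneg k
  rw [norm_neg, norm_smul, Complex.norm_real, Real.norm_eq_abs, abs_of_nonneg (by positivity),
    norm_chebCoeff]

/-- Pointwise bound on the Laplacian of the multiplier: `‖ΔΨ(x)‖ ≤ 4π/3 + 2π/3 = 2π`. [folklore] -/
theorem norm_laplacian_chebPsi_le (x : UnitAddTorus (Fin 3)) :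
    ‖Torus.laplacian chebPsi x‖ ≤ 2 * Real.pi := by
  rw [chebPsi, laplacian_realTrigPoly]
  refine (norm_realTrigPoly_apply_le _ _ x).trans (le_of_eq ?_)
  rw [sum_chebModes, norm_laplacianCoeff_chebPsi, norm_laplacianCoeff_chebPsi,
    norm_laplacianCoeff_chebPsi, norm_laplacianCoeff_chebPsi, freqNormSq_neg, freqNormSq_neg,
    freqNormSq_of_mem_kolModes kolFreq_mem, freqNormSq_chebFreq]
  simp only [Pi.neg_apply, kolFreq_apply_two, chebFreq_apply_two, chebAmp_one, chebAmp_three,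
    Int.reduceNeg, chebAmp_neg_one, chebAmp_neg_three]
  have hπ := Real.pi_pos
  field_simp
  ring

/-- `∫‖ΔΨ‖² ≤ (2π)²`. [folklore] -/
theorem integral_norm_sq_laplacian_chebPsi_le :
    ∫ x, ‖Torus.laplacian chebPsi x‖ ^ 2 ≤ (2 * Real.pi) ^ 2 := by
  calc ∫ x, ‖Torus.laplacian chebPsi x‖ ^ 2
      ≤ ∫ _ : UnitAddTorus (Fin 3), (2 * Real.pi) ^ 2 :=
        integral_mono_of_nonneg (Eventually.of_forall fun x => by positivity) (integrable_const _)
          (Eventually.of_forall fun x =>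
            pow_le_pow_left₀ (norm_nonneg _) (norm_laplacian_chebPsi_le x) 2)
    _ = (2 * Real.pi) ^ 2 := by rw [integral_const, probReal_univ, one_smul]

/-- **The Chebyshev floor at fixed viscosity, single solution.** For every global Leray–Hopf
solution of `NS_ν(cos(2πx₃)e₁)`, `ν > 0`, with `meanEnergy u ≤ E`:
`1/(6π) ≤ (√3/6)·E + 2π·ν·√E`. [cite: DoeringFoias2002, §3] -/
theorem kolmogorov_meanEnergy_floor_fixedViscosity {ν : ℝ}
    {u₀ : UnitAddTorus (Fin 3) → EuclideanSpace ℝ (Fin 3)}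
    {u : ℝ → UnitAddTorus (Fin 3) → EuclideanSpace ℝ (Fin 3)}
    (hu : Torus.IsGlobalLerayHopf ν (fun _ => kolForce) u₀ u) (hν : 0 < ν)
    {E : ℝ} (hE : meanEnergy u ≤ E) :
    1 / (6 * Real.pi) ≤ Real.sqrt 3 / 6 * E + 2 * Real.pi * ν * Real.sqrt E := by
  have h := forcePairing_le_of_meanEnergy_le hu hν isSmooth_kolForce hasZeroMean_kolForce
    isSmooth_chebPsi isDivFree_chebPsi (by positivity : (0 : ℝ) ≤ Real.sqrt 3 / 6)
    semidefinite_chebPsi hE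
  rw [integral_inner_kolForce_chebPsi] at h
  have hs : Real.sqrt (∫ x, ‖Torus.laplacian chebPsi x‖ ^ 2) ≤ 2 * Real.pi := by
    rw [← Real.sqrt_sq (by positivity : (0 : ℝ) ≤ 2 * Real.pi)]
    exact Real.sqrt_le_sqrt integral_norm_sq_laplacian_chebPsi_le
  have hE0 : 0 ≤ Real.sqrt E := Real.sqrt_nonneg _
  calc 1 / (6 * Real.pi)
      ≤ Real.sqrt 3 / 6 * E + ν * Real.sqrt (∫ x, ‖Torus.laplacian chebPsi x‖ ^ 2) * Real.sqrt E := h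
    _ ≤ Real.sqrt 3 / 6 * E + ν * (2 * Real.pi) * Real.sqrt E := by gcongr
    _ = Real.sqrt 3 / 6 * E + 2 * Real.pi * ν * Real.sqrt E := by ring

/-- The same floor solved for `E`: `E + 4√3·π·ν·√E ≥ 1/(π√3)` for every global Leray–Hopf solution
of the Kolmogorov-forced Navier–Stokes equations at viscosity `ν > 0` with `meanEnergy u ≤ E` — the
inertial floor `1/(π√3)` of `kolmogorov_energyBound_ge_chebyshev` is approached at rate `ν`.
[cite: DoeringFoias2002, §3] [cite: DoeringEckhardtSchumacher2003, Lemma 2] -/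
theorem kolmogorov_energyBound_ge_chebyshev_fixedViscosity {ν : ℝ}
    {u₀ : UnitAddTorus (Fin 3) → EuclideanSpace ℝ (Fin 3)}
    {u : ℝ → UnitAddTorus (Fin 3) → EuclideanSpace ℝ (Fin 3)}
    (hu : Torus.IsGlobalLerayHopf ν (fun _ => kolForce) u₀ u) (hν : 0 < ν)
    {E : ℝ} (hE : meanEnergy u ≤ E) :
    1 / (Real.pi * Real.sqrt 3) - 4 * Real.sqrt 3 * Real.pi * ν * Real.sqrt E ≤ E := by
  have h := kolmogorov_meanEnergy_floor_fixedViscosity hu hν hE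
  have hs : Real.sqrt 3 ^ 2 = 3 := Real.sq_sqrt (by norm_num)
  have hs0 : 0 < Real.sqrt 3 := Real.sqrt_pos.2 (by norm_num)
  have hπ := Real.pi_pos
  rw [sub_le_iff_le_add, div_le_iff₀ (by positivity)]
  -- `h : 1/(6π) ≤ √3/6·E + 2πν√E`; goal `1 ≤ (E + 4√3 π ν √E)·(π√3)` — the same number
  rw [div_le_iff₀ (by positivity)] at h
  have key : (E + 4 * Real.sqrt 3 * Real.pi * ν * Real.sqrt E) * (Real.pi * Real.sqrt 3) =
      (Real.sqrt 3 / 6 * E + 2 * Real.pi * ν * Real.sqrt E) * (6 * Real.pi) := by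
    linear_combination (4 * Real.pi ^ 2 * ν * Real.sqrt E) * hs
  rw [key]
  exact h

/-- In particular the mean energy itself obeys the floor:
`meanEnergy u + 4√3·π·ν·√(meanEnergy u) ≥ 1/(π√3)`. [folklore] -/
theorem kolmogorov_meanEnergy_ge_chebyshev_fixedViscosity {ν : ℝ}
    {u₀ : UnitAddTorus (Fin 3) → EuclideanSpace ℝ (Fin 3)}
    {u : ℝ → UnitAddTorus (Fin 3) → EuclideanSpace ℝ (Fin 3)}
    (hu : Torus.IsGlobalLerayHopf ν (fun _ => kolForce) u₀ u) (hν : 0 < ν) :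
    1 / (Real.pi * Real.sqrt 3) - 4 * Real.sqrt 3 * Real.pi * ν * Real.sqrt (meanEnergy u) ≤
      meanEnergy u :=
  kolmogorov_energyBound_ge_chebyshev_fixedViscosity hu hν le_rfl

end Summit.AnomalousDissipation.AnomalousDissipation.Theorems
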